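import Mathlib
import HarnessLib
import Literature.AlgebraicGeometry.Ramification.InertiaNormalSylow
import Literature.AlgebraicGeometry.Resolution.ResolutionOfSingularities
import Literature.AlgebraicGeometry.Resolution.AugmentationIdeal
import Summits.ResolutionOfSingularities.ResolutionOfSingularities.Theorems.WildQuotientsWildQuotientResolutionToralEndState
import Summits.ResolutionOfSingularities.ResolutionOfSingularities.Theorems.WildQuotientsWildQuotientResolutionStandardFormPClosed

/-!
# The STANDARD-FORM end state at the scheme level, and the reduction of Phase 0 to a p-standard-form model
# (crux `WildQuotients.WildQuotientResolution`, stub `stub_phaseZeroHighDim`; any dimension)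

Crux stmt-ResolutionOfSingularities-15640 (`WildQuotientResolution`), registered stub `stub_phaseZeroHighDim`
(Phase 0 for `dim X′ ≥ 3`: an equivariant proper birational REGULAR model with every inertia group p-closed and
a `G`-stable affine cover). ✓`StandardForm.hasNormalSylow_of_tameFix_le_boundary` (p821673) is the local
REICHSTEIN–YOUSSIN criterion in residue characteristic `p`: boundary equations with stable lines, and every tame
`g ≠ 1` of the inertia group having its fixed locus in the boundary to first order, force p-closed inertia —
with no condition on the top piece of the cotangent flag and no faithfulness. This file transports it to the
inertia group `I_x` of a point of a `G`-scheme through the stalk action (✓`PointBlowupStalkData.exists_stalkAction`,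
✓`InertLocusStalk.stalkAction_residueTrivial`), reads the fixed-locus hypothesis GEOMETRICALLY through the reduced
inert loci `Z_⟨g⟩ = {y | ⟨g⟩ ≤ I_y}` (✓`InertLocusStalk.stalkIdeal_vanishingIdeal_inertLocus_of_isUnit`: on a
regular stalk the germ of `Z_⟨g⟩` at `x` is cut out by `𝔞_{τ g}` for tame `g`), and records the resulting
REDUCTION of the stub, parallel to ✓`ToralPhaseZero.phaseZero_of_toralModel` (p820686) but with the weaker
standard-form end state and WITHOUT the faithfulness hypothesis:

**Theorem** (`phaseZero_of_standardFormModel`). For the crux data (`k` of characteristic `p`, `X₁/k` separated of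
finite type, `q : X′ → X₁` finite, `ρ` an action of the finite `G` on `X′`), every equivariant proper birational
model `π : X♯ → X′`, `X♯` integral and regular with a `G`-stable affine cover, which is in p-STANDARD FORM at every
point `x` — for the stalk action of `I_x` there are `z₁, …, z_n ∈ 𝔪_x ∖ 𝔪_x²` with stable lines such that every
element `g ≠ 1` of `I_x` of order prime to `p` has some `zᵢ ∈ 𝔞_{τ g} + 𝔪_x²` — satisfies every clause of the
conclusion of `stub_phaseZeroHighDim`.

So, in every dimension, `stub_phaseZeroHighDim` follows from p-STANDARDISATION: an equivariant sequence of blow-ups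
of the regular `X′` in regular `G`-stable centres after which the TAME inert loci `Z_⟨g⟩` (regular,
✓`TameFixedLocus`) lie in a `G`-strict normal crossings boundary — the characteristic-`p` form of the reduction to
standard form in Reichstein–Youssin (Canad. J. Math. 52 (2000), §3), which there rests on canonical embedded
resolution; here the non-free locus to be resolved is only the TAME one (a finite union of regular subschemes), the
wild fixed loci never entering.

[OURS · crux stmt-ResolutionOfSingularities-15640 · helper toward `stub_phaseZeroHighDim` (scheme-level standard-form
end state + reduction of the stub to a p-standard-form model; NOT a proof of the stub); folklore, counted 0;
AI-level work, weaker than expert review.] [folklore; cf. AbbesSaito2011 2.4, Reichstein–Youssin 2000 Thm. 4.1]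

* `hasNormalSylow_inertia_of_standardForm` — the scheme-level criterion (stalk-action form);
* `iSup_augIdeal_zpowers_le`, `mem_augIdeal_of_mem_stalkIdeal_inertLocus` — on a regular stalk, a boundary
  equation vanishing on the germ of the tame inert locus `Z_⟨g⟩` lies in `𝔞_{τ g}`;
* `hasNormalSylow_inertia_of_inertLoci_le_boundary` — the criterion with the GEOMETRIC fixed-locus hypothesis;
* `phaseZero_of_standardFormModel` — the reduction of `stub_phaseZeroHighDim`.
-/

-- single-problem summit: the doubled namespace component `ResolutionOfSingularities` is forced
set_option linter.dupNamespace false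

noncomputable section

open CategoryTheory AlgebraicGeometry TopologicalSpace IsLocalRing
open Literature.AlgebraicGeometry.Resolution Literature.AlgebraicGeometry.Ramification
open Summit.ResolutionOfSingularities.ResolutionOfSingularities.Theorems.WildQuotientResolution.PointBlowupStalkData
open Summit.ResolutionOfSingularities.ResolutionOfSingularities.Theorems.WildQuotientResolution.InertLocusStalk

namespace Summit.ResolutionOfSingularities.ResolutionOfSingularities.Theorems.WildQuotientResolution.StandardForm

/-! ## The criterion for the inertia group of a point -/

section Point

variable {X : Scheme.{0}} {G : Type} [Group G] [Finite G] (σ : G →* Aut X) (p : ℕ) [Fact p.Prime]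
  (x : X) [CharP (ResidueField (X.presheaf.stalk x)) p]

/-- **Standard form at `x` ⟹ `I_x` p-closed** (crux stmt-ResolutionOfSingularities-15640, toward
`stub_phaseZeroHighDim`; any dimension, any scheme). Let the finite group `G` act on the scheme `X` and let `x`
have residue characteristic `p`. Suppose that for the stalk action `(a, τ)` of `I_x` on `𝒪_{X,x}` (any package as
produced by ✓`exists_stalkAction`) there are `z₁, …, z_n ∈ 𝔪_x ∖ 𝔪_x²` with every line `κ z̄ᵢ` stable under `I_x`
(the boundary divisors through `x` are individually `I_x`-stable) such that every `g ≠ 1` in `I_x` of order prime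
to `p` has some `zᵢ ∈ 𝔞_{τ g} + 𝔪_x²`. Then `I_x` has a normal Sylow `p`-subgroup (✓p821673 through
✓`stalkAction_residueTrivial`; no faithfulness, integrality or Noetherian hypothesis). [folklore] -/
theorem hasNormalSylow_inertia_of_standardForm
    (hend : ∀ (a : inertiaSubgroup σ x → (X.presheaf.stalk x ⟶ X.presheaf.stalk x))
      (τ : inertiaSubgroup σ x →* (X.presheaf.stalk x ≃+* X.presheaf.stalk x)),
      (∀ g : inertiaSubgroup σ x,
        Spec.map (a g) ≫ X.fromSpecStalk x = X.fromSpecStalk x ≫ (σ (g : G)).hom) →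
      (∀ (g : inertiaSubgroup σ x) (s : X.presheaf.stalk x), τ g s = (a g⁻¹).hom s) →
      ∃ (n : ℕ) (z : Fin n → X.presheaf.stalk x),
        (∀ i, z i ∈ maximalIdeal (X.presheaf.stalk x)) ∧
        (∀ i, z i ∉ maximalIdeal (X.presheaf.stalk x) ^ 2) ∧
        (∀ (g : inertiaSubgroup σ x) (i : Fin n),
          τ g (z i) ∈ Ideal.span {z i} ⊔ maximalIdeal (X.presheaf.stalk x) ^ 2) ∧
        (∀ g : inertiaSubgroup σ x, g ≠ 1 → (orderOf g).Coprime p →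
          ∃ i, z i ∈ augIdeal (τ g) ⊔ maximalIdeal (X.presheaf.stalk x) ^ 2)) :
    HasNormalSylow p (inertiaSubgroup σ x) := by
  obtain ⟨a, τ, hkey, hτ⟩ := exists_stalkAction σ x (inertiaSubgroup σ x)
    (fun g hg => apply_eq_of_mem_inertiaSubgroup σ hg)
  have hres : ∀ (g : inertiaSubgroup σ x) (s : X.presheaf.stalk x),
      τ g s - s ∈ maximalIdeal (X.presheaf.stalk x) :=
    stalkAction_residueTrivial σ x a τ hkey hτ le_rfl
  obtain ⟨n, z, hz, hz2, hstab, hfix⟩ := hend a τ hkey hτ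
  exact hasNormalSylow_of_tameFix_le_boundary p τ hres z hz hz2 hstab hfix

/-! ## Reading the fixed-locus hypothesis on the reduced inert loci -/

variable {I : Subgroup G} (a : I → (X.presheaf.stalk x ⟶ X.presheaf.stalk x))
  (τ : I →* (X.presheaf.stalk x ≃+* X.presheaf.stalk x))

omit [Finite G] [Fact p.Prime] [CharP (ResidueField (X.presheaf.stalk x)) p] in
/-- The fixed-locus ideal of the cyclic group `⟨g⟩` is the augmentation ideal of `g`
(`𝔞_{g^n} ≤ 𝔞_g`, ✓`augIdeal_pow_le`). [folklore] -/
theorem iSup_augIdeal_zpowers_le (g : I) (hK : Subgroup.zpowers (g : G) ≤ I) :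
    (⨆ k : Subgroup.zpowers (g : G), augIdeal ((τ.comp (Subgroup.inclusion hK)) k)) ≤ augIdeal (τ g) := by
  refine iSup_le fun k => ?_
  obtain ⟨k, hk⟩ := k
  obtain ⟨m, hm⟩ := Subgroup.mem_zpowers_iff.mp hk
  have hkI : (⟨k, hK hk⟩ : I) = g ^ m := by
    apply Subtype.ext
    rw [Subgroup.coe_zpow, hm]
  have h1 : (τ.comp (Subgroup.inclusion hK)) ⟨k, hk⟩ = τ g ^ m := by
    rw [MonoidHom.comp_apply]
    change τ ⟨k, hK hk⟩ = _
    rw [hkI, map_zpow]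
  rw [h1]
  -- `𝔞_{σ^m} ≤ 𝔞_σ` for an integer power: reduce to natural powers of `σ` or `σ⁻¹`
  rcases Int.eq_nat_or_neg m with ⟨n, rfl | rfl⟩
  · rw [zpow_natCast]
    exact augIdeal_pow_le (τ g) n
  · rw [zpow_neg, zpow_natCast, ← inv_pow]
    refine (augIdeal_pow_le (τ g)⁻¹ n).trans ?_
    rw [augIdeal_def, Ideal.span_le]
    rintro _ ⟨b, rfl⟩
    have e : (τ g)⁻¹ b - b = -(τ g ((τ g)⁻¹ b) - (τ g)⁻¹ b) := by
      rw [← RingAut.mul_apply, mul_inv_cancel, RingAut.one_apply]; ring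
    change (τ g)⁻¹ b - b ∈ augIdeal (τ g)
    rw [e]
    exact neg_mem (sub_mem_augIdeal (τ g) _)

/-- **A boundary equation vanishing on the germ of a tame inert locus lies in the augmentation ideal.** Let
`(a, τ)` be a stalk action at `x` of a subgroup `I` fixing `x`, `𝒪_{X,x}` a REGULAR local ring of residue
characteristic `p`, and `g ∈ I ∩ I_x` of order prime to `p` with closed inert locus `Z_⟨g⟩ = {y | ⟨g⟩ ≤ I_y}`. If
`z ∈ 𝒪_{X,x}` lies in the stalk at `x` of the ideal of `Z_⟨g⟩` (the boundary divisor `z = 0` contains the germ of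
`Z_⟨g⟩` at `x`), then `z ∈ 𝔞_{τ g}` (✓`stalkIdeal_vanishingIdeal_inertLocus_of_isUnit`: for tame `⟨g⟩` the stalk
ideal IS the fixed-locus ideal, which is `𝔞_{τ g}`). [folklore] -/
theorem mem_augIdeal_of_mem_stalkIdeal_inertLocus [IsRegularLocalRing (X.presheaf.stalk x)]
    (hkey : ∀ g : I, Spec.map (a g) ≫ X.fromSpecStalk x = X.fromSpecStalk x ≫ (σ (g : G)).hom)
    (hτ : ∀ (g : I) (r : X.presheaf.stalk x), τ g r = (a g⁻¹).hom r)
    (g : I) (hg : (orderOf g).Coprime p) (hgx : (g : G) ∈ inertiaSubgroup σ x)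
    (hZ : IsClosed {y : X | Subgroup.zpowers (g : G) ≤ inertiaSubgroup σ y}) {z : X.presheaf.stalk x}
    (hz : z ∈ stalkIdeal (Scheme.IdealSheafData.vanishingIdeal
      ⟨{y : X | Subgroup.zpowers (g : G) ≤ inertiaSubgroup σ y}, hZ⟩) x) :
    z ∈ augIdeal (τ g) := by
  have hK : Subgroup.zpowers (g : G) ≤ I := (Subgroup.zpowers_le).mpr g.2
  have hKx : Subgroup.zpowers (g : G) ≤ inertiaSubgroup σ x := (Subgroup.zpowers_le).mpr hgx
  have hKu : IsUnit ((Nat.card (Subgroup.zpowers (g : G)) : ℕ) : X.presheaf.stalk x) := by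
    rw [Nat.card_zpowers, Subgroup.orderOf_coe]
    exact TameFixedLocus.isUnit_natCast_of_not_dvd p
      ((Nat.Prime.coprime_iff_not_dvd (Fact.out : p.Prime)).mp hg.symm)
  rw [stalkIdeal_vanishingIdeal_inertLocus_of_isUnit σ x a τ hkey hτ hK hKu hKx hZ] at hz
  exact iSup_augIdeal_zpowers_le x τ g hK hz

/-- **Tame inert loci in the boundary ⟹ `I_x` p-closed** (the criterion with the GEOMETRIC fixed-locus
hypothesis). Let `G` (finite) act on `X`, `x` a point with regular stalk of residue characteristic `p`, and assume
the inert loci `Z_⟨g⟩` of the tame elements `g ∈ I_x` are closed (✓`InertiaLocus.stub_isClosed_inertiaLocus` over an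
affine invariant base). If for the stalk action of `I_x` there are boundary equations `z₁, …, z_n ∈ 𝔪_x ∖ 𝔪_x²` with
stable lines such that for every `g ≠ 1` in `I_x` of order prime to `p` some boundary divisor `zᵢ = 0` contains the
germ of `Z_⟨g⟩` at `x` (`zᵢ ∈ (𝓘_{Z_⟨g⟩})_x`), then `I_x` has a normal Sylow `p`-subgroup. [folklore] -/
theorem hasNormalSylow_inertia_of_inertLoci_le_boundary [IsRegularLocalRing (X.presheaf.stalk x)]
    (hcl : ∀ g : G, g ∈ inertiaSubgroup σ x →
      IsClosed {y : X | Subgroup.zpowers g ≤ inertiaSubgroup σ y})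
    (hend : ∀ (a : inertiaSubgroup σ x → (X.presheaf.stalk x ⟶ X.presheaf.stalk x))
      (τ : inertiaSubgroup σ x →* (X.presheaf.stalk x ≃+* X.presheaf.stalk x)),
      (∀ g : inertiaSubgroup σ x,
        Spec.map (a g) ≫ X.fromSpecStalk x = X.fromSpecStalk x ≫ (σ (g : G)).hom) →
      (∀ (g : inertiaSubgroup σ x) (s : X.presheaf.stalk x), τ g s = (a g⁻¹).hom s) →
      ∃ (n : ℕ) (z : Fin n → X.presheaf.stalk x),
        (∀ i, z i ∈ maximalIdeal (X.presheaf.stalk x)) ∧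
        (∀ i, z i ∉ maximalIdeal (X.presheaf.stalk x) ^ 2) ∧
        (∀ (g : inertiaSubgroup σ x) (i : Fin n),
          τ g (z i) ∈ Ideal.span {z i} ⊔ maximalIdeal (X.presheaf.stalk x) ^ 2) ∧
        (∀ (g : inertiaSubgroup σ x) (hg1 : g ≠ 1) (hg : (orderOf g).Coprime p),
          ∃ i, z i ∈ stalkIdeal (Scheme.IdealSheafData.vanishingIdeal
            ⟨{y : X | Subgroup.zpowers (g : G) ≤ inertiaSubgroup σ y}, hcl g g.2⟩) x)) :
    HasNormalSylow p (inertiaSubgroup σ x) := by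
  refine hasNormalSylow_inertia_of_standardForm σ p x fun a τ hkey hτ => ?_
  obtain ⟨n, z, hz, hz2, hstab, hfix⟩ := hend a τ hkey hτ
  refine ⟨n, z, hz, hz2, hstab, fun g hg1 hg => ?_⟩
  obtain ⟨i, hi⟩ := hfix g hg1 hg
  exact ⟨i, Ideal.mem_sup_left
    (mem_augIdeal_of_mem_stalkIdeal_inertLocus σ p x a τ hkey hτ g hg g.2 (hcl g g.2) hi)⟩

end Point

/-! ## The reduction of `stub_phaseZeroHighDim` to a p-standard-form model -/

/-- **A p-standard-form equivariant regular model is a Phase-0 model** (crux stmt-ResolutionOfSingularities-15640,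
reduction of `stub_phaseZeroHighDim`; any dimension). Crux data: `k` of characteristic `p`, `X₁/k` separated of
finite type, `X′` a scheme with `q : X′ → X₁` finite and an action `ρ` of the finite `G`. Let `π : X♯ → X′` with
`ρ♯` be an equivariant proper birational model, `X♯` integral and regular with a `G`-stable affine cover, in
p-STANDARD FORM at every point `x ∈ X♯`: for the stalk action `(a, τ)` of `I_x` there are
`z₁, …, z_n ∈ 𝔪_x ∖ 𝔪_x²` with stable lines `κ z̄ᵢ` such that every `g ≠ 1` in `I_x` of order prime to `p` has some
`zᵢ ∈ 𝔞_{τ g} + 𝔪_x²`. Then `(X♯, π, ρ♯)` has all the properties demanded by `stub_phaseZeroHighDim`; in particular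
every inertia group of `ρ♯` is p-closed (`hasNormalSylow_inertia_of_standardForm`). No faithfulness is needed.
[folklore] -/
theorem phaseZero_of_standardFormModel (p : ℕ) (hp : p.Prime) (k : Type) [Field k] [CharP k p]
    (X' X₁ : Scheme.{0}) (f : X₁ ⟶ Spec (.of k)) (q : X' ⟶ X₁) (G : Type) [Group G] [Finite G]
    (ρ : G →* Aut X')
    (Xs : Scheme.{0}) (π : Xs ⟶ X') (ρs : G →* Aut Xs) [IsProper π] (hbir : IsBirational π)
    [IsIntegral Xs] (hXsreg : Scheme.IsRegular Xs) (hequiv : ∀ g : G, (ρs g).hom ≫ π = π ≫ (ρ g).hom)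
    (hcov : ∀ x : Xs, ∃ U : Xs.Opens, IsAffineOpen U ∧ x ∈ U ∧ ∀ g : G, (ρs g).hom ⁻¹ᵁ U = U)
    (hstd : ∀ (x : Xs) (a : inertiaSubgroup ρs x → (Xs.presheaf.stalk x ⟶ Xs.presheaf.stalk x))
      (τ : inertiaSubgroup ρs x →* (Xs.presheaf.stalk x ≃+* Xs.presheaf.stalk x)),
      (∀ g : inertiaSubgroup ρs x,
        Spec.map (a g) ≫ Xs.fromSpecStalk x = Xs.fromSpecStalk x ≫ (ρs (g : G)).hom) →
      (∀ (g : inertiaSubgroup ρs x) (s : Xs.presheaf.stalk x), τ g s = (a g⁻¹).hom s) →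
      ∃ (n : ℕ) (z : Fin n → Xs.presheaf.stalk x),
        (∀ i, z i ∈ maximalIdeal (Xs.presheaf.stalk x)) ∧
        (∀ i, z i ∉ maximalIdeal (Xs.presheaf.stalk x) ^ 2) ∧
        (∀ (g : inertiaSubgroup ρs x) (i : Fin n),
          τ g (z i) ∈ Ideal.span {z i} ⊔ maximalIdeal (Xs.presheaf.stalk x) ^ 2) ∧
        (∀ g : inertiaSubgroup ρs x, g ≠ 1 → (orderOf g).Coprime p →
          ∃ i, z i ∈ augIdeal (τ g) ⊔ maximalIdeal (Xs.presheaf.stalk x) ^ 2)) :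
    ∃ (Xs : Scheme.{0}) (π : Xs ⟶ X') (ρs : G →* Aut Xs), IsProper π ∧ IsBirational π ∧
      IsIntegral Xs ∧ Scheme.IsRegular Xs ∧ (∀ g : G, (ρs g).hom ≫ π = π ≫ (ρ g).hom) ∧
      (∀ x : Xs, HasNormalSylow p (inertiaSubgroup ρs x)) ∧
      ∀ x : Xs, ∃ U : Xs.Opens, IsAffineOpen U ∧ x ∈ U ∧ ∀ g : G, (ρs g).hom ⁻¹ᵁ U = U := by
  haveI : Fact p.Prime := ⟨hp⟩
  -- residue characteristics of `X♯` (a scheme over `k` through `π ≫ q ≫ f`)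
  have hcharS : ∀ x : Xs, CharP (ResidueField (Xs.presheaf.stalk x)) p := fun x =>
    (((IsLocalRing.residue (Xs.presheaf.stalk x)).comp ((Xs.presheaf.germ ⊤ x trivial).hom.comp
      (((π ≫ q ≫ f).appTop).hom.comp (Scheme.ΓSpecIso (.of k)).inv.hom))).charP_iff_charP p).mp
      inferInstance
  refine ⟨Xs, π, ρs, ‹IsProper π›, hbir, ‹IsIntegral Xs›, hXsreg, hequiv, fun x => ?_, hcov⟩
  haveI := hcharS x
  exact hasNormalSylow_inertia_of_standardForm ρs p x (hstd x)

end Summit.ResolutionOfSingularities.ResolutionOfSingularities.Theorems.WildQuotientResolution.StandardForm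

end
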